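import Literature.AnabelianGeometry.EtaleTheta.GalSectSplittingsCohomology
import Literature.AnabelianGeometry.EtaleTheta.GalSectSplittingsTransport
import Literature.AnabelianGeometry.EtaleTheta.ContH1Discrete
import HarnessLib

/-!
# [GalSect] §4: the class transport is EQUIVARIANT for the genuine `H¹`-torsors — O1's binder (b2)
# discharged at the cohomological structure group (proof-only)

S. Mochizuki, *Galois sections in absolute anabelian geometry* [GalSect], Nagoya Math. J. **179** (2005), §4
p.33 ("… form a torsor over `H¹(G_K, Ẑ(1))`") [cite: MochizukiGalSect2005, §4 p.33]; classical input: Brown,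
*Cohomology of Groups*, Ch. IV §2 (complements ↔ `H¹`, functorial in isomorphisms of the data)
[cite: Brown1982CohomologyGroups, Ch. IV §2 Prop. 2.1 and Prop. 2.3]; consumer: [EtTh] Thm. 1.10 (iii)
[cite: MochizukiEtTh2009, Thm 1.10 (iii) p.30].  abc-iut cell, layer L2, seat abc-iut-w5-d062 (gen 3),
self-directed row «O1-(b2) at the genuine torsor», FILE (B).  PROOF-ONLY: no definitions, no named facts.

abc-iut-w5-d029's `GalSect.CuspPair.torsorDataH1` (GalSectSplittingsCohomology.lean) is the GENUINE torsor of
print: the splitting classes of `P = (D, I)` (`D` closed, `I` compact abelian, one splitting `S₀`) under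
`Ker(res : H¹(D, I) → H¹(I, I))`.  In O1 (`thm110iiiGalSect_of_transport`) the transport `e` of splitting
classes along the extension `Γ` of `γ` is assumed EQUIVARIANT along a homomorphism `φ` of structure groups
(binder `hequiv`).  Here this is PROVED for the genuine torsors:

* `ContH1.transport_mem_contCocycles` / `exists_transportHom` — transport of continuous cocycles along an
  isomorphism of topological groups `Θ : E ≃* E'` carrying the coefficients `A` into `A'` descends to a
  homomorphism `T : H¹(E, A) → H¹(E', A')` (`H = ⊤`);
* `ContH1.IsClosedComplement.transport_classOf` — `T` carries the class of a closed complement `K` to the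
  class of `Θ(K)` (uniqueness of the `A`-coordinate);
* `GalSect.CuspPair.splittingClassEquivResKer_mk_coe` — the value of w5-d029's identification on a class:
  `[S] ↦ [π_{S₀}]⁻¹ · [π_S]`;
* **`GalSect.CuspPair.exists_torsorDataH1_equivariant`** — for a pair-preserving `Γ : G ≃ₜ* G'`
  (`P.map Γ = P'`) and THE class transport `e` (`e [S] = [Γ S]`, FILE (A)), there is an ISOMORPHISM of
  structure groups `φ : Ker(res)_P ≃* Ker(res)_{P'}` (bases `S₀ ↦ Γ S₀`) with
  `e (k • c) = φ(k) • e(c)` — O1's `hequiv`; `φ` is unique (`torsorData_equivariant_unique`).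

HONEST SCOPE: `φ` lives on `Ker(res) ⊆ H¹(D, I)`; the identification of this group with `(K^×)^∧` and of
`φ` with the isomorphism `K̈_α^× ⥲ K̈_β^×` "induced by `γ`" is Kummer theory / [AbsAnab] Prop. 1.2.1 (the
origin predicate's content) and is NOT touched.  [GalSect] is refereed; nothing here bears on [IUTchIII]
Cor. 3.12; typed ≠ proved for anything of [EtTh].
-/

noncomputable section

namespace Literature.AnabelianGeometry.EtaleTheta

open scoped Pointwise IsMulCommutative

/-! ### Transport of `H¹` along an isomorphism of the data `(E, A)` -/

namespace ContH1

variable {E E' : Type*} [Group E] [TopologicalSpace E] [IsTopologicalGroup E]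
  [Group E'] [TopologicalSpace E'] [IsTopologicalGroup E']
  {A : Subgroup E} [A.Normal] [IsMulCommutative A] {A' : Subgroup E'} [A'.Normal] [IsMulCommutative A']

/-- Every class is the class of a cocycle. [cite: NeukirchSchmidtWingberg2008, I §2 and II §7] -/
theorem exists_eq_mk {G G'' : Type*} [Group G] [TopologicalSpace G] [Group G''] [TopologicalSpace G'']
    [IsTopologicalGroup G''] {φ : G →* G''} {B : Subgroup G''} [B.Normal] [IsMulCommutative B]
    {H : Subgroup G} (x : ContH1 φ B H) : ∃ (f : H → B) (hf : f ∈ contCocycles φ B H), x = ContH1.mk f hf := by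
  induction x using QuotientGroup.induction_on with
  | H f => exact ⟨f.1, f.2, rfl⟩

/-- **Transport of a continuous cocycle** along an isomorphism of topological groups `Θ : E ≃ E'` carrying
`A` into `A'`: `h' ↦ Θ (f (Θ⁻¹ h'))` is a continuous cocycle. [cite: Brown1982CohomologyGroups, Ch. IV §2 Prop. 2.1 and Prop. 2.3] -/
theorem transport_mem_contCocycles (Θ : E ≃* E') (hΘ : Continuous Θ) (hΘs : Continuous Θ.symm)
    (hA : ∀ a : A, Θ a ∈ A') {f : (⊤ : Subgroup E) → A}
    (hf : f ∈ contCocycles (MonoidHom.id E) A ⊤) :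
    (fun h' : (⊤ : Subgroup E') =>
        (⟨Θ (f ⟨Θ.symm h', Subgroup.mem_top _⟩), hA _⟩ : A')) ∈ contCocycles (MonoidHom.id E') A' ⊤ := by
  refine ⟨?_, ?_⟩
  · apply Continuous.subtype_mk
    exact hΘ.comp (continuous_subtype_val.comp (hf.1.comp
      (Continuous.subtype_mk (hΘs.comp continuous_subtype_val) _)))
  · intro g h
    apply Subtype.ext
    have hmul : (⟨Θ.symm ((g * h : (⊤ : Subgroup E')) : E'), Subgroup.mem_top _⟩ : (⊤ : Subgroup E)) =
        ⟨Θ.symm (g : E'), Subgroup.mem_top _⟩ * ⟨Θ.symm (h : E'), Subgroup.mem_top _⟩ :=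
      Subtype.ext (by simp)
    dsimp only
    rw [hmul, hf.2]
    simp only [Subgroup.coe_mul, map_mul, MulAut.conjNormal_apply, MonoidHom.id_apply, map_inv,
      MulEquiv.apply_symm_apply]

omit [TopologicalSpace E] [IsTopologicalGroup E] [TopologicalSpace E'] [IsTopologicalGroup E'] in
/-- **Transport of a continuous coboundary** is a coboundary. [cite: Brown1982CohomologyGroups, Ch. IV §2 Prop. 2.1 and Prop. 2.3] -/
theorem transport_mem_contCoboundaries (Θ : E ≃* E') (hA : ∀ a : A, Θ a ∈ A') {f : (⊤ : Subgroup E) → A}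
    (hf : f ∈ contCoboundaries (MonoidHom.id E) A ⊤) :
    (fun h' : (⊤ : Subgroup E') =>
        (⟨Θ (f ⟨Θ.symm h', Subgroup.mem_top _⟩), hA _⟩ : A')) ∈ contCoboundaries (MonoidHom.id E') A' ⊤ := by
  obtain ⟨a, rfl⟩ := hf
  refine ⟨⟨Θ a, hA a⟩, ?_⟩
  funext h'
  apply Subtype.ext
  simp only [Subgroup.coe_mul, Subgroup.coe_inv, MulAut.conjNormal_apply, MonoidHom.id_apply, map_mul,
    map_inv, MulEquiv.apply_symm_apply]

/-- **The transport homomorphism on `H¹`** along `Θ : (E, A) ≃ (E', A')`: a homomorphism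
`T : H¹(E, A) → H¹(E', A')` with `T [f] = [Θ ∘ f ∘ Θ⁻¹]` EXISTS (no definition is introduced: `T` is
bound). [cite: Brown1982CohomologyGroups, Ch. IV §2 Prop. 2.1 and Prop. 2.3] -/
theorem exists_transportHom (Θ : E ≃* E') (hΘ : Continuous Θ) (hΘs : Continuous Θ.symm)
    (hA : ∀ a : A, Θ a ∈ A') :
    ∃ T : ContH1 (MonoidHom.id E) A ⊤ →* ContH1 (MonoidHom.id E') A' ⊤,
      ∀ (f : (⊤ : Subgroup E) → A) (hf : f ∈ contCocycles (MonoidHom.id E) A ⊤),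
        T (ContH1.mk f hf) = ContH1.mk (fun h' : (⊤ : Subgroup E') =>
          (⟨Θ (f ⟨Θ.symm h', Subgroup.mem_top _⟩), hA _⟩ : A')) (transport_mem_contCocycles Θ hΘ hΘs hA hf) := by
  -- the cocycle-level homomorphism
  let tc : contCocycles (MonoidHom.id E) A ⊤ →* contCocycles (MonoidHom.id E') A' ⊤ :=
    { toFun := fun f => ⟨_, transport_mem_contCocycles Θ hΘ hΘs hA f.2⟩
      map_one' := by
        apply Subtype.ext
        funext h'
        apply Subtype.ext
        simp
      map_mul' := fun f g => by
        apply Subtype.ext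
        funext h'
        apply Subtype.ext
        simp }
  have htc : (contCoboundaries (MonoidHom.id E) A ⊤).subgroupOf (contCocycles (MonoidHom.id E) A ⊤) ≤
      ((contCoboundaries (MonoidHom.id E') A' ⊤).subgroupOf (contCocycles (MonoidHom.id E') A' ⊤)).comap tc := by
    intro f hf
    rw [Subgroup.mem_comap, Subgroup.mem_subgroupOf]
    exact transport_mem_contCoboundaries Θ hA (Subgroup.mem_subgroupOf.mp hf)
  refine ⟨QuotientGroup.map _ _ tc htc, fun f hf => ?_⟩
  rfl

namespace IsClosedComplement

omit [IsTopologicalGroup E] [IsTopologicalGroup E'] [IsMulCommutative A] [IsMulCommutative A'] in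
/-- **Transport of the class of a closed complement**: if `Θ(K) ⊆ K'` for closed complements `K` of `A` in
`E` and `K'` of `A'` in `E'`, then the transported coordinate of `K` IS the coordinate of `K'`, so
`T [π_K] = [π_{K'}]`. [cite: Brown1982CohomologyGroups, Ch. IV §2 Prop. 2.1 and Prop. 2.3] -/
theorem transport_coord_eq (Θ : E ≃* E') (hA : ∀ a : A, Θ a ∈ A') {K : Subgroup E} {K' : Subgroup E'}
    (hK : IsClosedComplement A ⊤ K) (hK' : IsClosedComplement A' ⊤ K') (hKK' : ∀ k ∈ K, Θ k ∈ K') :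
    (fun h' : (⊤ : Subgroup E') => (⟨Θ (hK.coord ⟨Θ.symm h', Subgroup.mem_top _⟩), hA _⟩ : A')) = hK'.coord := by
  funext h'
  symm
  apply Subtype.ext
  apply hK'.coord_eq_of_inv_mul_mem h' (hA _)
  have hmem := hK.coord_inv_mul_mem ⟨Θ.symm h', Subgroup.mem_top _⟩
  have := hKK' _ hmem
  simpa [map_mul, map_inv, MulEquiv.apply_symm_apply] using this

/-- Hence a transport homomorphism carries `classOf K` to `classOf K'`.
[cite: Brown1982CohomologyGroups, Ch. IV §2 Prop. 2.1 and Prop. 2.3] -/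
theorem transport_classOf (Θ : E ≃* E') (hΘ : Continuous Θ) (hΘs : Continuous Θ.symm)
    (hA : ∀ a : A, Θ a ∈ A') (hAc : IsCompact (A : Set E)) (hA'c : IsCompact (A' : Set E'))
    {T : ContH1 (MonoidHom.id E) A ⊤ →* ContH1 (MonoidHom.id E') A' ⊤}
    (hT : ∀ (f : (⊤ : Subgroup E) → A) (hf : f ∈ contCocycles (MonoidHom.id E) A ⊤),
        T (ContH1.mk f hf) = ContH1.mk (fun h' : (⊤ : Subgroup E') =>
          (⟨Θ (f ⟨Θ.symm h', Subgroup.mem_top _⟩), hA _⟩ : A')) (transport_mem_contCocycles Θ hΘ hΘs hA hf))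
    {K : Subgroup E} {K' : Subgroup E'} (hK : IsClosedComplement A ⊤ K) (hK' : IsClosedComplement A' ⊤ K')
    (hKK' : ∀ k ∈ K, Θ k ∈ K') :
    T (hK.classOf hAc) = hK'.classOf hA'c := by
  change T (ContH1.mk hK.coord (hK.coord_mem_contCocycles hAc)) = ContH1.mk hK'.coord _
  rw [hT]
  exact ContH1.mk_congr ⊤ (hK.transport_coord_eq Θ hA hK' hKK') _ _

end IsClosedComplement

end ContH1

/-! ### The genuine torsors of [GalSect] §4 are functorial -/

namespace GalSect

namespace CuspPair

variable {G G' : Type*} [Group G] [TopologicalSpace G] [IsTopologicalGroup G] [T1Space G]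
  [Group G'] [TopologicalSpace G'] [IsTopologicalGroup G'] [T1Space G']

/-- **The value of w5-d029's identification on a class**: `[S] ↦ [π_{S₀}]⁻¹ · [π_S]` in `H¹(D, I)`
(`π_S` = the `I`-coordinate of `D = I · S`). [cite: MochizukiGalSect2005, §4 p.33] -/
theorem splittingClassEquivResKer_mk_coe (P : CuspPair G) [IsMulCommutative P.I] (hD : IsClosed (P.D : Set G))
    (hI : IsCompact (P.I : Set G)) {S₀ : Subgroup G} (hS₀ : S₀ ∈ P.splittings) (S : Subgroup G)
    (hS : S ∈ P.splittings) :
    haveI := P.ID_normal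
    ((P.splittingClassEquivResKer hD hI hS₀ (SplittingClass.mk P S hS) :
        ContH1.resKer P.ID (⊤ : Subgroup P.D) (P.isClosedComplement_of_mem_splittings hS₀).le_left) :
        ContH1 (MonoidHom.id P.D) P.ID ⊤) =
      ((P.isClosedComplement_of_mem_splittings hS₀).classOf (P.isCompact_ID hI))⁻¹ *
        (P.isClosedComplement_of_mem_splittings hS).classOf (P.isCompact_ID hI) :=
  rfl

section Equivariance

variable {P : CuspPair G} {P' : CuspPair G'} [IsMulCommutative P.I] [IsMulCommutative P'.I] {Γ : G ≃ₜ* G'}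

omit [IsTopologicalGroup G] [T1Space G] [IsTopologicalGroup G'] [T1Space G'] [IsMulCommutative P.I]
  [IsMulCommutative P'.I] in
/-- A pair-preserving `Γ` carries `D` into `D'` — bookkeeping for the transport. [cite: MochizukiGalSect2005, §4 p.33] -/
theorem mapsTo_D (hpair : P.map Γ = P') {x : G} (hx : x ∈ P.D) : Γ x ∈ P'.D := by
  subst hpair
  exact ⟨x, hx, rfl⟩

/-- **Equivariance of the class transport for the genuine `H¹`-torsors** ([GalSect] §4 functoriality; O1's
binder `hequiv` as a THEOREM): for a pair-preserving isomorphism `Γ` (`P.map Γ = P'`), base splittings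
`S₀ ↦ Γ S₀`, and the class transport `e` (`e [S] = [Γ S]`), there is an isomorphism of structure groups
`φ : Ker(res)_P ≃* Ker(res)_{P'}` with `e (k • c) = φ(k) • e(c)` for all `k`, `c`.
[cite: MochizukiGalSect2005, §4 p.33] -/
theorem exists_torsorDataH1_equivariant (hpair : P.map Γ = P')
    (hD : IsClosed (P.D : Set G)) (hI : IsCompact (P.I : Set G))
    (hD' : IsClosed (P'.D : Set G')) (hI' : IsCompact (P'.I : Set G'))
    {S₀ : Subgroup G} (hS₀ : S₀ ∈ P.splittings) (hS₀' : S₀.map Γ.toMulEquiv.toMonoidHom ∈ P'.splittings)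
    {e : P.SplittingClass → P'.SplittingClass}
    (he : ∀ (S : Subgroup G) (hS : S ∈ P.splittings),
      ∃ h', e (SplittingClass.mk P S hS) = SplittingClass.mk P' (S.map Γ.toMulEquiv.toMonoidHom) h') :
    haveI := P.ID_normal
    haveI := P'.ID_normal
    ∃ φ : ContH1.resKer P.ID (⊤ : Subgroup P.D) (P.isClosedComplement_of_mem_splittings hS₀).le_left ≃*
        ContH1.resKer P'.ID (⊤ : Subgroup P'.D) (P'.isClosedComplement_of_mem_splittings hS₀').le_left,
      ∀ k c, e ((P.torsorDataH1 hD hI hS₀).act k c) = (P'.torsorDataH1 hD' hI' hS₀').act (φ k) (e c) := by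
  haveI := P.ID_normal
  haveI := P'.ID_normal
  -- the restriction `Θ : ↥D ≃* ↥D'` of `Γ`
  have hDD : ∀ x : P.D, Γ (x : G) ∈ P'.D := fun x => mapsTo_D hpair x.2
  have hDD' : ∀ y : P'.D, Γ.symm (y : G') ∈ P.D := fun y => mapsTo_D (map_symm_of_map_eq hpair) y.2
  let Θ : P.D ≃* P'.D :=
    { toFun := fun x => ⟨Γ (x : G), hDD x⟩
      invFun := fun y => ⟨Γ.symm (y : G'), hDD' y⟩
      left_inv := fun x => Subtype.ext (Γ.symm_apply_apply (x : G))
      right_inv := fun y => Subtype.ext (Γ.apply_symm_apply (y : G'))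
      map_mul' := fun x y => Subtype.ext (map_mul Γ (x : G) (y : G)) }
  have hΘapply : ∀ x : P.D, ((Θ x : P'.D) : G') = Γ (x : G) := fun x => rfl
  have hΘ : Continuous Θ := Continuous.subtype_mk (Γ.continuous.comp continuous_subtype_val) _
  have hΘs : Continuous Θ.symm :=
    Continuous.subtype_mk (Γ.symm.continuous.comp continuous_subtype_val) _
  have hA : ∀ a : P.ID, Θ a ∈ P'.ID := by
    intro a
    rw [Subgroup.mem_subgroupOf]
    change Γ ((a : P.D) : G) ∈ P'.I
    rw [← hpair]
    exact ⟨(a : P.D), Subgroup.mem_subgroupOf.mp a.2, rfl⟩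
  -- the transport homomorphism on `H¹(D, I)`
  obtain ⟨T, hT⟩ := ContH1.exists_transportHom Θ hΘ hΘs hA
  have hIc := P.isCompact_ID hI
  have hIc' := P'.isCompact_ID hI'
  -- `T` carries the class of (the complement of) a splitting `S` to that of `Γ S`
  have hTcl : ∀ (S : Subgroup G) (hS : S ∈ P.splittings) (hS' : S.map Γ.toMulEquiv.toMonoidHom ∈ P'.splittings),
      T ((P.isClosedComplement_of_mem_splittings hS).classOf hIc) =
        (P'.isClosedComplement_of_mem_splittings hS').classOf hIc' := by
    intro S hS hS'
    refine ContH1.IsClosedComplement.transport_classOf Θ hΘ hΘs hA hIc hIc' hT _ _ ?_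
    intro k hk
    rw [Subgroup.mem_subgroupOf] at hk ⊢
    rw [hΘapply]
    exact ⟨(k : G), hk, rfl⟩
  -- the identifications `E`, `E'` and the bijection `e`
  set EE := P.splittingClassEquivResKer hD hI hS₀ with hEE
  set EE' := P'.splittingClassEquivResKer hD' hI' hS₀' with hEE'
  have hebij := classTransport_bijective hpair he
  -- key: `E' (e c) = T (E c)` in `H¹(D', I')`
  have hkey : ∀ c : P.SplittingClass,
      ((EE' (e c) : _) : ContH1 (MonoidHom.id P'.D) P'.ID ⊤) = T ((EE c : _) : ContH1 (MonoidHom.id P.D) P.ID ⊤) := by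
    intro c
    obtain ⟨S, hS, rfl⟩ := SplittingClass.exists_rep P c
    have hS' : S.map Γ.toMulEquiv.toMonoidHom ∈ P'.splittings := by
      rw [← hpair]; exact P.map_mem_splittings Γ hS
    rw [classTransport_mk he S hS hS', hEE, hEE', splittingClassEquivResKer_mk_coe,
      splittingClassEquivResKer_mk_coe, map_mul, map_inv, hTcl S₀ hS₀ hS₀', hTcl S hS hS']
  -- the candidate `ψ := E' ∘ e ∘ E⁻¹`, a bijection which is `T` on elements, hence multiplicative
  let ψ : ContH1.resKer P.ID (⊤ : Subgroup P.D) (P.isClosedComplement_of_mem_splittings hS₀).le_left ≃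
      ContH1.resKer P'.ID (⊤ : Subgroup P'.D) (P'.isClosedComplement_of_mem_splittings hS₀').le_left :=
    (EE.symm.trans (Equiv.ofBijective e hebij)).trans EE'
  have hψ : ∀ k, ((ψ k : _) : ContH1 (MonoidHom.id P'.D) P'.ID ⊤) = T (k : ContH1 (MonoidHom.id P.D) P.ID ⊤) := by
    intro k
    change ((EE' (e (EE.symm k)) : _) : ContH1 (MonoidHom.id P'.D) P'.ID ⊤) = _
    rw [hkey, Equiv.apply_symm_apply]
  have hψmul : ∀ k₁ k₂, ψ (k₁ * k₂) = ψ k₁ * ψ k₂ := by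
    intro k₁ k₂
    apply Subtype.ext
    rw [Subgroup.coe_mul, hψ, hψ, hψ, Subgroup.coe_mul, map_mul]
  refine ⟨MulEquiv.mk' ψ hψmul, fun k c => ?_⟩
  -- equivariance: both sides are `E'⁻¹` of something; apply `E'` and compute in `H¹(D', I')`
  have hL : (P.torsorDataH1 hD hI hS₀).act k c = EE.symm (k * EE c) := rfl
  have hR : (P'.torsorDataH1 hD' hI' hS₀').act (MulEquiv.mk' ψ hψmul k) (e c) =
      EE'.symm (ψ k * EE' (e c)) := rfl
  rw [hL, hR]
  apply EE'.injective
  rw [Equiv.apply_symm_apply]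
  apply Subtype.ext
  rw [hkey, Equiv.apply_symm_apply, Subgroup.coe_mul, map_mul, Subgroup.coe_mul, hψ, hkey]

omit [IsTopologicalGroup G] [T1Space G] [IsTopologicalGroup G'] [T1Space G'] [IsMulCommutative P.I]
  [IsMulCommutative P'.I] in
/-- **Uniqueness of `φ`**: the action being free, a map `φ` with `e (k • c) = φ(k) • e(c)` is determined by
`e` (indeed by one class `c₀`) — for ANY torsor structures. [cite: MochizukiGalSect2005, §4 p.33] -/
theorem torsorData_equivariant_unique {A B : Type*} [Group A] [Group B] (T : P.TorsorData A)
    (T' : P'.TorsorData B) {e : P.SplittingClass → P'.SplittingClass} {φ₁ φ₂ : A → B}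
    (h₁ : ∀ k c, e (T.act k c) = T'.act (φ₁ k) (e c)) (h₂ : ∀ k c, e (T.act k c) = T'.act (φ₂ k) (e c))
    (c₀ : P.SplittingClass) : φ₁ = φ₂ := by
  funext k
  exact (T'.existsUnique_act_eq (e c₀) (e (T.act k c₀))).unique (h₁ k c₀).symm (h₂ k c₀).symm

end Equivariance

end CuspPair

end GalSect

end Literature.AnabelianGeometry.EtaleTheta

end
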